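import Summits.ResolutionOfSingularities.ResolutionOfSingularities.Theorems.FrobeniusLadderFInjectiveMacaulayficationCentreSpread
import Summits.ResolutionOfSingularities.ResolutionOfSingularities.Theorems.FrobeniusLadderFInjectiveMacaulayficationNonFullLocusClosed
import Summits.ResolutionOfSingularities.ResolutionOfSingularities.Theorems.FrobeniusLadderFInjectiveMacaulayficationSliceableCentre
import Literature.AlgebraicGeometry.Resolution.BlowupStalkBlowupAlgebra
import Literature.AlgebraicGeometry.Resolution.BlowupsExistence
import Literature.AlgebraicGeometry.Resolution.BlowupsProperProofs
import Literature.AlgebraicGeometry.Resolution.BlowupsIntegral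
import Literature.AlgebraicGeometry.Resolution.Blowups
import Mathlib.AlgebraicGeometry.Morphisms.UniversallyClosed
import HarnessLib

/-!
# (T2′) kernel: a LocFix datum at `η` SPREADS to a centre `J` whose blow-ups are FULL over an open `U ∋ η`
# (crux `FInjectiveMacaulayfication` stmt-ResolutionOfSingularities-15315, chain w45a, HOLE #3 route (A′); res-L1-w45a-plan-1 R16.12 (4)
# «stub-2: OBJECT NOW = (T2′) `SpreadGoodAprime` KERNEL»; statement shape = res-L1-w45a-stub-3 `FC2Dim4Sig.lean` v0.7 `e54c78aab5d13002`
# §2 (T2′); seat res-L1-w45a-stub-2)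

[OURS · L1 W4.5a] Support file (`--supports stmt-ResolutionOfSingularities-15315 --as helper`); NOT a statement of any manuscript; CONDITIONAL on
`NonFullLocusClosed.NonFullLocusClosed` (closedness of the non-FULL locus of an integral variety — itself the two printed theorems
Datta–Murayama 2024 Thm. B + EGA IV₂ 6.11.2 BY NAME, tree `NonFullLocusClosed.nonFullLocusClosed_of_named`); def-free; AI-written (AI review is
weaker than expert review).

THE THEOREM `exists_spread_full_of_locFixData (hNF)`: `X₁` an integral `k`-scheme of finite type (`k` a field of characteristic `p`), `η ∈ X₁`,
`c′` finitely many germs at `η` with `(c′) ≠ ⊥`, `(c′) ≤ 𝔪_η`, and every prime `𝔔` OVER `𝔪_η` of every affine blow-up chart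
`𝒪_{X₁,η}[(c′)/c′_j]` FULL (`SliceableCentre.FullCl p (𝒪_{X₁,η}[(c′)/c′_j])_𝔔` — the (A′) LocFix datum of FC″, fibre over `𝔪_η` ONLY). Then there
are an ideal sheaf `J ≠ ⊥` with `η ∈ supp J`, `J_η = (c′)`, and an open `U ∋ η` such that EVERY blowing up `X₂ → X₁` along `J` is FULL at EVERY
point over `U` (closed or not). In particular (§2) it is «good over `supp J ∩ U`» in the sense of (T2′): FULL at the non-closed points, CM at the
closed ones.

PROOF. `J` := the spread of `(c′)` (tree `CentreSpread.centreSpread`). Fix ONE blowing up `π : X₂ → X₁` along `J` (`exists_isBlowup`); it is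
proper (`IsBlowup.isProper`) and `X₂` is integral (`IsBlowup.isIntegral`), of finite type over `k`. By `hNF` the non-FULL locus `Z ⊆ X₂` is
closed, so `B := π(Z)` is closed. `η ∉ B`: a point `x₂ ∈ Z` over `η` has local ring `(𝒪_η[(c′)/c′_j])_𝔔` with `𝔔` over `𝔪_η` (chart–stalk
dictionary `IsBlowup.exists_blowupAlgebra_stalk_ringEquiv`, Stacks 0804), FULL by the datum — contradiction. `U := X₁ ∖ B`. Any other blowing
up `π′ : X₂′ → X₁` along `J` is `X₂` over `X₁` up to isomorphism (`IsBlowup.unique`), which identifies stalks; a point of `X₂` over `U` lies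
outside `Z`, so it is FULL (domain because `X₂` is integral). NOTE: fullness over the proper generizations of `η` is NOT assumed — it FOLLOWS
(closedness of `Z` + properness of `π`): this is why the datum over `𝔪_η` alone (FC2Dim4Sig's `LocFixData`, not `LocFixDataFull`) suffices.
[cite: DattaMurayama2024, Thm. B] [cite: StacksProject, Tag 0804] [cite: GortzWedhorn2020, Prop. 13.91 and 13.96]
-/

-- single-problem summit: the doubled namespace component is forced
set_option linter.dupNamespace false

noncomputable section

namespace Summit.ResolutionOfSingularities.ResolutionOfSingularities.Theorems.FInjectiveMacaulayfication.SpreadLocFix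

open CategoryTheory AlgebraicGeometry TopologicalSpace IsLocalRing
open Literature.AlgebraicGeometry.Resolution
open Summit.ResolutionOfSingularities.ResolutionOfSingularities.Theorems.FInjectiveMacaulayfication
open SliceableCentre

/-! ## §1 One blowing up: the image of the non-FULL locus misses `η` -/

/-- **Blowing ups are FULL over the complement of the image of the non-FULL locus**, and that image misses `η` when the blow-up algebra
charts over `𝔪_η` are FULL. Packaged: the spread `J` of `(c′)` and an open `U ∋ η` over which every blowing up along `J` is FULL.
[OURS · conditional on `NonFullLocusClosed`] [cite: StacksProject, Tag 0804] -/
theorem exists_spread_full_of_locFixData (hNF : NonFullLocusClosed.NonFullLocusClosed)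
    (p : ℕ) (hp : p.Prime) (k : Type) [Field k] [CharP k p] (X₁ : Scheme.{0}) (f₁ : X₁ ⟶ Spec (.of k))
    [LocallyOfFiniteType f₁] [QuasiCompact f₁] [IsIntegral X₁]
    (η : X₁) (n' : ℕ) (c' : Fin n' → X₁.presheaf.stalk η)
    (h0 : Ideal.span (Set.range c') ≠ ⊥) (hle : Ideal.span (Set.range c') ≤ maximalIdeal (X₁.presheaf.stalk η))
    (hfull : ∀ (j : Fin n') (𝔔 : PrimeSpectrum (blowupAlgebra (Ideal.span (Set.range c')) (c' j))),
      𝔔.asIdeal.comap (algebraMap (X₁.presheaf.stalk η) (blowupAlgebra (Ideal.span (Set.range c')) (c' j))) =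
        maximalIdeal (X₁.presheaf.stalk η) → FullCl p (Localization.AtPrime 𝔔.asIdeal)) :
    ∃ (J : X₁.IdealSheafData) (U : X₁.Opens), J ≠ ⊥ ∧ η ∈ (J.support : Set X₁) ∧
      stalkIdeal J η = Ideal.span (Set.range c') ∧ η ∈ (U : Set X₁) ∧
      ∀ (X₂ : Scheme.{0}) (π : X₂ ⟶ X₁), IsBlowup π J → ∀ x : X₂, π.base x ∈ (U : Set X₁) → FullCl p (X₂.presheaf.stalk x) := by
  classical
  haveI : Fact p.Prime := ⟨hp⟩
  haveI : IsNoetherian X₁ := ClosedPointsOfClosedFinite.isNoetherian_of_locallyOfFiniteType_of_quasiCompact f₁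
  -- the spread `J` of `(c′)`
  obtain ⟨J, hJ0, hηJ, hJη⟩ := CentreSpread.centreSpread X₁ η n' c' h0 hle
  -- ONE blowing up along `J`
  obtain ⟨X₂, π, hπ⟩ := exists_isBlowup X₁ J
  haveI : IsProper π := hπ.isProper
  haveI : IsIntegral X₂ := hπ.isIntegral hJ0
  -- its non-FULL locus `Z` is closed (the two openness theorems, via `hNF`), hence so is `B := π(Z)`
  have hZ : IsClosed {x : X₂ | ¬ NonFullLocusClosed.Clause p (X₂.presheaf.stalk x)} :=
    hNF p hp k X₂ (π ≫ f₁) inferInstance inferInstance inferInstance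
  have hBc : IsClosed (π.base '' {x : X₂ | ¬ NonFullLocusClosed.Clause p (X₂.presheaf.stalk x)}) := π.isClosedMap _ hZ
  -- `η ∉ B`: the points over `η` are localizations of the blow-up algebra charts at primes over `𝔪_η`, FULL by the datum
  have hηB : η ∉ π.base '' {x : X₂ | ¬ NonFullLocusClosed.Clause p (X₂.presheaf.stalk x)} := by
    rintro ⟨x₂, hx₂, hx₂η⟩
    subst hx₂η
    obtain ⟨j, 𝔔, χ, e, -, -, -, h𝔔⟩ := hπ.exists_blowupAlgebra_stalk_ringEquiv x₂ c' hJη.symm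
    apply hx₂
    unfold NonFullLocusClosed.Clause
    exact DegreeZeroDescent.inlineClause_of_ringEquiv p e.symm (hfull j 𝔔 h𝔔).2
  refine ⟨J, ⟨_, hBc.isOpen_compl⟩, hJ0, hηJ, hJη, hηB, ?_⟩
  -- any blowing up along `J` is `X₂` up to an `X₁`-isomorphism, which identifies stalks
  intro X₂' π' hπ' x' hx'
  obtain ⟨e, he, -⟩ := hπ'.unique hπ
  have hx₂ : π.base (e.hom.base x') = π'.base x' := by
    rw [← Scheme.Hom.comp_apply, he]
  have hgood : NonFullLocusClosed.Clause p (X₂.presheaf.stalk (e.hom.base x')) := by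
    by_contra hbad
    exact hx' ⟨e.hom.base x', hbad, hx₂⟩
  unfold NonFullLocusClosed.Clause at hgood
  let ex : X₂.presheaf.stalk (e.hom.base x') ≃+* X₂'.presheaf.stalk x' := (asIso (e.hom.stalkMap x')).commRingCatIsoToRingEquiv
  exact ⟨MulEquiv.isDomain _ ex.symm.toMulEquiv, DegreeZeroDescent.inlineClause_of_ringEquiv p ex hgood⟩

/-! ## §2 «Good over `supp J ∩ U`» (FC2Dim4Sig (T2′) conclusion shape) -/

/-- **(T2′) in the binder shape of `FC2Dim4Sig.SpreadGoodAprime`'s conclusion** (`GoodOver p X₁ J (supp J ∩ U)` unfolded: FULL at the non-closed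
points over `supp J ∩ U`, CM-clause at the closed ones), from the (A′) datum over `𝔪_η` only. The hypotheses `IsSeparated f₁`,
`4 ≤ topologicalKrullDim X₁` and «all stalks CM» of (T2′) are not needed and not taken. [OURS · conditional on `NonFullLocusClosed`] -/
theorem exists_spread_goodOver_of_locFixData (hNF : NonFullLocusClosed.NonFullLocusClosed)
    (p : ℕ) (hp : p.Prime) (k : Type) [Field k] [CharP k p] (X₁ : Scheme.{0}) (f₁ : X₁ ⟶ Spec (.of k))
    [LocallyOfFiniteType f₁] [QuasiCompact f₁] [IsIntegral X₁]
    (η : X₁) (n' : ℕ) (c' : Fin n' → X₁.presheaf.stalk η)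
    (h0 : Ideal.span (Set.range c') ≠ ⊥) (hle : Ideal.span (Set.range c') ≤ maximalIdeal (X₁.presheaf.stalk η))
    (hfull : ∀ (j : Fin n') (𝔔 : PrimeSpectrum (blowupAlgebra (Ideal.span (Set.range c')) (c' j))),
      𝔔.asIdeal.comap (algebraMap (X₁.presheaf.stalk η) (blowupAlgebra (Ideal.span (Set.range c')) (c' j))) =
        maximalIdeal (X₁.presheaf.stalk η) → FullCl p (Localization.AtPrime 𝔔.asIdeal)) :
    ∃ (J : X₁.IdealSheafData) (U : X₁.Opens), J ≠ ⊥ ∧ η ∈ (J.support : Set X₁) ∧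
      stalkIdeal J η = Ideal.span (Set.range c') ∧ η ∈ (U : Set X₁) ∧
      ∀ (X₂ : Scheme.{0}) (π : X₂ ⟶ X₁), IsBlowup π J →
        (∀ x : X₂, π.base x ∈ (J.support : Set X₁) ∩ (U : Set X₁) → ¬ IsClosed ({x} : Set X₂) →
          FullCl p (X₂.presheaf.stalk x)) ∧
        (∀ x : X₂, π.base x ∈ (J.support : Set X₁) ∩ (U : Set X₁) → IsClosed ({x} : Set X₂) →
          CMCl (X₂.presheaf.stalk x)) := by
  obtain ⟨J, U, hJ0, hηJ, hJη, hηU, hgood⟩ := exists_spread_full_of_locFixData hNF p hp k X₁ f₁ η n' c' h0 hle hfull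
  refine ⟨J, U, hJ0, hηJ, hJη, hηU, fun X₂ π hπ => ⟨fun x hx _ => hgood X₂ π hπ x hx.2, fun x hx _ => ?_⟩⟩
  obtain ⟨-, hF⟩ := hgood X₂ π hπ x hx.2
  exact fun d hd s hs => (hF d hd s hs).1

/-- The same two theorems from the printed theorems BY NAME: Datta–Murayama 2024 Thm. B (`DattaMurayama2024_fInjectiveLocusOpen`) and
openness of the Cohen–Macaulay locus (`NonFullLocusClosed.CMLocusOpen`, EGA IV₂ 6.11.2 — typed as the Literature fact
`EGAIV2_cohenMacaulayLocusOpen` by res-L1-w45a-stub-7, p564252). [OURS · conditional-result] [cite: DattaMurayama2024, Thm. B] -/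
theorem exists_spread_goodOver_of_DM_CMLocusOpen
    (hDM : Literature.AlgebraicGeometry.Resolution.DattaMurayama2024_fInjectiveLocusOpen.{0})
    (hCMo : NonFullLocusClosed.CMLocusOpen)
    (p : ℕ) (hp : p.Prime) (k : Type) [Field k] [CharP k p] (X₁ : Scheme.{0}) (f₁ : X₁ ⟶ Spec (.of k))
    [LocallyOfFiniteType f₁] [QuasiCompact f₁] [IsIntegral X₁]
    (η : X₁) (n' : ℕ) (c' : Fin n' → X₁.presheaf.stalk η)
    (h0 : Ideal.span (Set.range c') ≠ ⊥) (hle : Ideal.span (Set.range c') ≤ maximalIdeal (X₁.presheaf.stalk η))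
    (hfull : ∀ (j : Fin n') (𝔔 : PrimeSpectrum (blowupAlgebra (Ideal.span (Set.range c')) (c' j))),
      𝔔.asIdeal.comap (algebraMap (X₁.presheaf.stalk η) (blowupAlgebra (Ideal.span (Set.range c')) (c' j))) =
        maximalIdeal (X₁.presheaf.stalk η) → FullCl p (Localization.AtPrime 𝔔.asIdeal)) :
    ∃ (J : X₁.IdealSheafData) (U : X₁.Opens), J ≠ ⊥ ∧ η ∈ (J.support : Set X₁) ∧
      stalkIdeal J η = Ideal.span (Set.range c') ∧ η ∈ (U : Set X₁) ∧
      ∀ (X₂ : Scheme.{0}) (π : X₂ ⟶ X₁), IsBlowup π J →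
        (∀ x : X₂, π.base x ∈ (J.support : Set X₁) ∩ (U : Set X₁) → ¬ IsClosed ({x} : Set X₂) →
          FullCl p (X₂.presheaf.stalk x)) ∧
        (∀ x : X₂, π.base x ∈ (J.support : Set X₁) ∩ (U : Set X₁) → IsClosed ({x} : Set X₂) →
          CMCl (X₂.presheaf.stalk x)) :=
  exists_spread_goodOver_of_locFixData (NonFullLocusClosed.nonFullLocusClosed_of_named hDM hCMo)
    p hp k X₁ f₁ η n' c' h0 hle hfull

/-! ## §3 «Good over ALL of `U`» (res-L1-w45a-plan-1 R16.33 (4): the currency downstream steps consume) -/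

/-- **(T2′) with conclusion over the WHOLE open `U ∋ η`**, not only over `supp J ∩ U`: every blowing up along `J` is FULL at every non-closed
point over `U` and CM at every closed point over `U` (indeed FULL at all of them — `exists_spread_full_of_locFixData`; `U = X₁ ∖ π(non-FULL locus)`
for one, hence every, blowing up `π`). [OURS · conditional on `NonFullLocusClosed`] -/
theorem exists_spread_goodOver_all_of_locFixData (hNF : NonFullLocusClosed.NonFullLocusClosed)
    (p : ℕ) (hp : p.Prime) (k : Type) [Field k] [CharP k p] (X₁ : Scheme.{0}) (f₁ : X₁ ⟶ Spec (.of k))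
    [LocallyOfFiniteType f₁] [QuasiCompact f₁] [IsIntegral X₁]
    (η : X₁) (n' : ℕ) (c' : Fin n' → X₁.presheaf.stalk η)
    (h0 : Ideal.span (Set.range c') ≠ ⊥) (hle : Ideal.span (Set.range c') ≤ maximalIdeal (X₁.presheaf.stalk η))
    (hfull : ∀ (j : Fin n') (𝔔 : PrimeSpectrum (blowupAlgebra (Ideal.span (Set.range c')) (c' j))),
      𝔔.asIdeal.comap (algebraMap (X₁.presheaf.stalk η) (blowupAlgebra (Ideal.span (Set.range c')) (c' j))) =
        maximalIdeal (X₁.presheaf.stalk η) → FullCl p (Localization.AtPrime 𝔔.asIdeal)) :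
    ∃ (J : X₁.IdealSheafData) (U : X₁.Opens), J ≠ ⊥ ∧ η ∈ (J.support : Set X₁) ∧
      stalkIdeal J η = Ideal.span (Set.range c') ∧ η ∈ (U : Set X₁) ∧
      ∀ (X₂ : Scheme.{0}) (π : X₂ ⟶ X₁), IsBlowup π J →
        (∀ x : X₂, π.base x ∈ (U : Set X₁) → ¬ IsClosed ({x} : Set X₂) → FullCl p (X₂.presheaf.stalk x)) ∧
        (∀ x : X₂, π.base x ∈ (U : Set X₁) → IsClosed ({x} : Set X₂) → CMCl (X₂.presheaf.stalk x)) := by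
  obtain ⟨J, U, hJ0, hηJ, hJη, hηU, hgood⟩ := exists_spread_full_of_locFixData hNF p hp k X₁ f₁ η n' c' h0 hle hfull
  refine ⟨J, U, hJ0, hηJ, hJη, hηU, fun X₂ π hπ => ⟨fun x hx _ => hgood X₂ π hπ x hx, fun x hx _ => ?_⟩⟩
  obtain ⟨-, hF⟩ := hgood X₂ π hπ x hx
  exact fun d hd s hs => (hF d hd s hs).1

/-- The same from the two printed openness theorems BY NAME. [OURS · conditional-result] [cite: DattaMurayama2024, Thm. B] -/
theorem exists_spread_goodOver_all_of_DM_CMLocusOpen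
    (hDM : Literature.AlgebraicGeometry.Resolution.DattaMurayama2024_fInjectiveLocusOpen.{0})
    (hCMo : NonFullLocusClosed.CMLocusOpen)
    (p : ℕ) (hp : p.Prime) (k : Type) [Field k] [CharP k p] (X₁ : Scheme.{0}) (f₁ : X₁ ⟶ Spec (.of k))
    [LocallyOfFiniteType f₁] [QuasiCompact f₁] [IsIntegral X₁]
    (η : X₁) (n' : ℕ) (c' : Fin n' → X₁.presheaf.stalk η)
    (h0 : Ideal.span (Set.range c') ≠ ⊥) (hle : Ideal.span (Set.range c') ≤ maximalIdeal (X₁.presheaf.stalk η))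
    (hfull : ∀ (j : Fin n') (𝔔 : PrimeSpectrum (blowupAlgebra (Ideal.span (Set.range c')) (c' j))),
      𝔔.asIdeal.comap (algebraMap (X₁.presheaf.stalk η) (blowupAlgebra (Ideal.span (Set.range c')) (c' j))) =
        maximalIdeal (X₁.presheaf.stalk η) → FullCl p (Localization.AtPrime 𝔔.asIdeal)) :
    ∃ (J : X₁.IdealSheafData) (U : X₁.Opens), J ≠ ⊥ ∧ η ∈ (J.support : Set X₁) ∧
      stalkIdeal J η = Ideal.span (Set.range c') ∧ η ∈ (U : Set X₁) ∧
      ∀ (X₂ : Scheme.{0}) (π : X₂ ⟶ X₁), IsBlowup π J →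
        (∀ x : X₂, π.base x ∈ (U : Set X₁) → ¬ IsClosed ({x} : Set X₂) → FullCl p (X₂.presheaf.stalk x)) ∧
        (∀ x : X₂, π.base x ∈ (U : Set X₁) → IsClosed ({x} : Set X₂) → CMCl (X₂.presheaf.stalk x)) :=
  exists_spread_goodOver_all_of_locFixData (NonFullLocusClosed.nonFullLocusClosed_of_named hDM hCMo)
    p hp k X₁ f₁ η n' c' h0 hle hfull

end Summit.ResolutionOfSingularities.ResolutionOfSingularities.Theorems.FInjectiveMacaulayfication.SpreadLocFix

end
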